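import Literature.Barriers.AnomalousDissipation.AnomalousDissipationWithoutDissipationAnomalyProofs
import Literature.Analysis.FluidPDE.CheskidovNoAnomalyAssembly
import Literature.Analysis.FluidPDE.PassiveScalarWellPosednessProofs
import Literature.Analysis.FluidPDE.QuasiSelfSimilarFamilyProofs
import Literature.Analysis.FluidPDE.QuasiSelfSimilarCompatibleBlocksProofs
import HarnessLib

/-!
# Barrier (AnomalousDissipation): Cheskidov's no-dissipation-anomaly barrier from the
Alberti–Crippa–Mazzucato blocks alone (arXiv:2311.04182, Thm. 2.1, `e = 0`)

Theorem-only assembly file for the named fact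
`Literature.Barriers.AnomalousDissipation.Cheskidov2023_thm21_noDissipationAnomaly`
(`AnomalousDissipationWithoutDissipationAnomaly.lean`; Cheskidov 2023, Thm. 2.1, second subfamily
with energy level `e = 0`: anomalous dissipation of the vanishing-viscosity limit without
dissipation anomaly). Its printed proof (§3–§4) has three inputs, all of which are now theorems
of the tree except the last kinematic leaf:

1. the `2½`-dimensional assembly of §4, p. 12 and Lemma 3.2 — PROVED:
   `Cheskidov2023_thm21_noDissipationAnomaly_of_noAnomalyFamily`
   (`AnomalousDissipationWithoutDissipationAnomalyProofs.lean`) from the planar core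
   `Literature.Analysis.FluidPDE.cheskidov_noAnomaly_family`;
2. the planar core (§3 (3.2)–(3.13), §4 (4.2)–(4.3), (4.19)) — PROVED from the quasi-self-similar
   mixing family and parabolic well-posedness:
   `Literature.Analysis.FluidPDE.cheskidov_noAnomaly_family_of_acm`
   (`CheskidovNoAnomalyAssembly.lean`), the well-posedness of (4.2) being the theorem
   `Literature.Analysis.FluidPDE.Torus.exists_unique_isClassicalScalarTransportForcedOn_holds`
   (`PassiveScalarWellPosednessProofs.lean`; Krylov 1996, Thm. 9.2.3);
3. the mixing family (Cheskidov 2023, Thm. 3.1 = Bruè–De Lellis 2023, Thm. 4.1;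
   Alberti–Crippa–Mazzucato 2019) — the named fact
   `Literature.Analysis.FluidPDE.alberti_crippa_mazzucato_family`, PROVED in the tree from the
   structural fact `acm_building_blocks` (`QuasiSelfSimilarFamilyProofs.lean`), itself PROVED from
   the kinematic leaf `Literature.Analysis.FluidPDE.acm_compatible_blocks`
   (`QuasiSelfSimilarCompatibleBlocksProofs.lean`: the two generating moves of the Peano snake
   with their gate structure, ACM 2019, §8.1, §8.4–8.6, given in the source by Figures 7–9).

Composing, the barrier follows from the mixing family alone
(`Cheskidov2023_thm21_noDissipationAnomaly_of_mixingFamily`), from the `n`-uniform reading of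
BDL Thm. 4.1 (c) (`…_of_quasiSelfSimilar`), from the structural fact (`…_of_buildingBlocks`) and
from the current kinematic leaf (`…_of_compatibleBlocks`). What remains for
`Cheskidov2023_thm21_noDissipationAnomaly_holds` is therefore exactly `acm_compatible_blocks_holds`.

## References

* A. Cheskidov, *Dissipation anomaly and anomalous dissipation in incompressible fluid flows*,
  arXiv:2311.04182 (2023): Thm. 2.1 (p. 8), Thm. 3.1 and (3.2)–(3.13) (p. 10), Lemma 3.2
  (p. 11), §4 pp. 12–14 ((4.2), (4.3), (4.19)).
* E. Bruè, C. De Lellis, *Anomalous dissipation for the forced 3D Navier–Stokes equations*,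
  Comm. Math. Phys. 400 (2023), Thm. 4.1, §4.1 (i)–(iv), Lemma 5.1 (arXiv:2207.06301, pp. 9–10).
* G. Alberti, G. Crippa, A. L. Mazzucato, *Exponential self-similar mixing by incompressible
  flows*, J. Amer. Math. Soc. 32 (2019), §6.2, §8.1, §8.4–8.8 (arXiv:1605.02090).
* N. V. Krylov, *Lectures on Elliptic and Parabolic Equations in Hölder Spaces* (1996), Thm. 9.2.3.
-/

noncomputable section

namespace Literature.Barriers.AnomalousDissipation

open Literature.Analysis.FluidPDE

/-- **The barrier from the mixing family alone.** Cheskidov's Thm. 2.1 (`e = 0`) follows from the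
single named fact `alberti_crippa_mazzucato_family` (Cheskidov 2023, Thm. 3.1 = Bruè–De Lellis
2023, Thm. 4.1, supports per level): the planar core by `cheskidov_noAnomaly_family_of_acm` with
the proved parabolic well-posedness `Torus.exists_unique_isClassicalScalarTransportForcedOn_holds`
("let `θ^m` be the unique smooth solution of (4.2)", §4 p. 12), then the `2½`-dimensional
assembly `Cheskidov2023_thm21_noDissipationAnomaly_of_noAnomalyFamily` (§4 p. 12, Lemma 3.2). [cite: Cheskidov2023, Thm. 2.1, Thm. 3.1 and §4 pp. 12–13] -/
theorem Cheskidov2023_thm21_noDissipationAnomaly_of_mixingFamily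
    (h : alberti_crippa_mazzucato_family) : Cheskidov2023_thm21_noDissipationAnomaly :=
  Cheskidov2023_thm21_noDissipationAnomaly_of_noAnomalyFamily
    (cheskidov_noAnomaly_family_of_acm h Torus.exists_unique_isClassicalScalarTransportForcedOn_holds)

/-- **Deprecated** (2026-08-16) with its hypothesis, the mis-stated `n`-uniform reading of BDL
Thm. 4.1 (c) (`alberti_crippa_mazzucato_quasi_self_similar`, deprecated in
`QuasiSelfSimilarMixing.lean`): use `Cheskidov2023_thm21_noDissipationAnomaly_of_mixingFamily`.
*Content (unchanged):* the barrier from that reading, which implies the per-level family. [cite: BrueDeLellisCMP2023, Thm. 4.1] [cite: Cheskidov2023, Thm. 2.1] -/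
@[deprecated Cheskidov2023_thm21_noDissipationAnomaly_of_mixingFamily (since := "2026-08-16")]
theorem Cheskidov2023_thm21_noDissipationAnomaly_of_quasiSelfSimilar
    (h : alberti_crippa_mazzucato_quasi_self_similar) : Cheskidov2023_thm21_noDissipationAnomaly :=
  Cheskidov2023_thm21_noDissipationAnomaly_of_mixingFamily h.family

/-- **The barrier from the structural building-block fact** `acm_building_blocks` (finitely many
Alberti–Crippa–Mazzucato building blocks patching smoothly with handover; ACM 2019, §8, as used in
Bruè–De Lellis 2023, §4.1 and Thm. 4.1), through the scaling analysis
`alberti_crippa_mazzucato_family_of_building_blocks`. [cite: BrueDeLellisCMP2023, Thm. 4.1] [cite: Cheskidov2023, Thm. 2.1 and Thm. 3.1] -/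
theorem Cheskidov2023_thm21_noDissipationAnomaly_of_buildingBlocks (h : acm_building_blocks) :
    Cheskidov2023_thm21_noDissipationAnomaly :=
  Cheskidov2023_thm21_noDissipationAnomaly_of_mixingFamily
    (alberti_crippa_mazzucato_family_of_building_blocks h)

/-- **The barrier from the kinematic leaf** `acm_compatible_blocks` (the compatible block system
of the Peano snake: ACM 2019, §8.1 (a)–(e), §8.4 (a)–(c), §8.6; Bruè–De Lellis 2023, §4.1
(i)–(iv)), through `acm_building_blocks_of_compatible_blocks`. This is the whole remaining debt of
`Cheskidov2023_thm21_noDissipationAnomaly`: its discharge is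
`Cheskidov2023_thm21_noDissipationAnomaly_of_compatibleBlocks acm_compatible_blocks_holds` once the
leaf is proved. [cite: Cheskidov2023, Thm. 2.1 and Thm. 3.1] [cite: AlbertiCrippaMazzucato2019, §8.1, §8.4, §8.6] -/
theorem Cheskidov2023_thm21_noDissipationAnomaly_of_compatibleBlocks (h : acm_compatible_blocks) :
    Cheskidov2023_thm21_noDissipationAnomaly :=
  Cheskidov2023_thm21_noDissipationAnomaly_of_buildingBlocks
    (acm_building_blocks_of_compatible_blocks h)

end Literature.Barriers.AnomalousDissipation

end
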